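import Literature.AnabelianGeometry.SemiGraphs.CoveringGraphGaloisCountableNegativeThm37
import Literature.AnabelianGeometry.SemiGraphs.CoveringGraphApproximators
import Literature.AnabelianGeometry.SemiGraphs.WitnessIwahoriCoherent
import Literature.AnabelianGeometry.SemiGraphs.TemperedReconstructionR3Refutation
import HarnessLib

/-!
# The covering semi-graph `G_{S_ω}` of the Thm-3.7-grade countermodel IS quasi-coherent: the heredity
# failure of p463023 sits EXACTLY at Galois-countability (T2)

abc-iut cell, layer L3, route T · T7d∞-NEG37-QC (seat abc-iut-L3-t5, gen 8; sequel to
`CoveringGraphGaloisCountableNegativeThm37`).  FRONTIER label: erratum-grade TIGHTNESS datum for the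
cell's own heredity theorems of route T (`CoveringGraphCoherent`, `CoveringGraphFiniteDegree`,
`CoveringGraphApproximators`, `CoveringGraphGaloisCountableNegativeThm37`); it retypes and changes NO
statement of record and lies outside the [IUTchIII] Cor. 3.12 cone.  Source of the notions: S. Mochizuki,
*Semi-graphs of anabelioids*, Publ. RIMS **42** (2006), Def. 2.3 (i)–(iii) pp. 24–25 (approximators,
quasi-coherent, coherent), Def. 2.4 pp. 25–26, Def. 3.5 (i)–(ii) p. 37 (the covering semi-graph
`G_S → G` of `S ∈ B^cov(G)`, tree `CovObj.coveringGraph`; tempered coverings), Prop. 3.6 p. 38,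
Thm. 3.7 p. 40 [cite: MochizukiSemiAnbd2006, Def 2.3(iii) p.25]; Galois-countability [IUTchI]
Rmk. 2.5.3 (i) (T2) p. 52 [cite: Mochizuki2012, IUTchI Rmk 2.5.3 (i) (T2), p. 52].

RECALL (`CoveringGraphGaloisCountableNegativeThm37`, p463023): over the Thm-3.7-grade, NON-coherent loop
`𝒢_ω = seqLoop p` (vertex group `P_ω = ℤ_p^ℕ ⋊ U`, `U = 1 + pℤ_p`, edge group `U`) the `ℤ`-unwinding
`S_ω = seqUnwinding p` is a connected tempered covering of infinite degree whose covering semi-graph of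
anabelioids `G_{S_ω}` (the bi-infinite chain, all vertex groups `P_ω`, all edge groups `U`) is NOT
Galois-countable.  THIS FILE decides every OTHER clause of `Prop36Hypotheses` / `Thm37Hypotheses` at
`G_{S_ω}` — all of them HOLD:
* **`isQuasiCoherent_coveringGraph_seqUnwinding`** (the one clause needing an argument; note that the
  cell's heredity theorem for quasi-coherence, `CovObj.isQuasiCoherent_coveringGraph_of_finite`, needs a
  COHERENT base and does not apply).  Given test objects of size `≤ M` at every component (vertex or edge) of the chain,
  take the UNIFORM `U`-level `W := charOpenCore U M` (open: `U` is topologically finitely generated,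
  `IwU.exists_finset_topologicalClosure_eq_top`); at a vertex `v'` the finite quotient of `Π_{v'} = P_ω`
  by `fixator(H_{v'}) ∩ s⁻¹(W)` (`s : P_ω → U`, `x ↦ 1 + p·x.s`, the projection), at an edge the quotient `U / W`; the
  branch maps of the approximator are induced by the covering branch homomorphisms
  `k ↦ g_{b'} b_c(k) g_{b'}⁻¹`, well defined because `W` fixes every `U`-set of size `≤ M` pulled back
  along them (`CovObj.charOpenCore_acts_trivially`) and INJECTIVE because `s ∘ (g b_c(·) g⁻¹) = id_U`
  (`U` is abelian, `IwahoriWitness.IwU_mul_comm`); orders bounded by `(M! · [U : W])!`;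
* connected / countable / a vertex / injective type / verticially slim (`CoveringGraphHypothesesBasic`),
  totally aloof and estranged (`CoveringGraphEstranged`), totally elevated
  (`CovObj.isTotallyElevated_coveringGraph`) — by name; NOT coherent (`P_ω` is not topologically finitely
  generated);
* records **`prop36Hypotheses_coveringGraph_seqUnwinding_iff`** / **`thm37Hypotheses_coveringGraph_seqUnwinding_iff`**:
  at `G_{S_ω}` the bundles are EQUIVALENT to their (T2)-clause (hence false), and the packaged
  **`exists_thm37Hypotheses_coveringGraph_all_clauses_but_galoisCountable`**.
So the heredity failure recorded by p463023 is located exactly at (T2): "coherent" in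
`CovObj.isGaloisCountable_coveringGraph_of_isCoherent` cannot be weakened to "quasi-coherent" even when
the covering graph itself stays quasi-coherent.  Honest framing: a tightness datum for OUR typed heredity
theorems (print's Prop. 3.6 (v) assumes coherence; [IUTchI] uses finite coherent graphs); nothing here
bears on [IUTchIII] Cor. 3.12.
-/

noncomputable section

open CategoryTheory Topology

namespace Literature.AnabelianGeometry.SemiGraphs

open Literature.AlgebraicGeometry.Frobenioids (IsConnectedObj)
open Literature.AnabelianGeometry.AbsoluteAnabelian (IsTopologicallyFinitelyGenerated)
open ProfiniteSemiGraph IwahoriWitness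

universe u

variable {p : ℕ} [Fact p.Prime]

/-! ### 1. Preliminaries on `U = 1 + pℤ_p` and on the projection `P_ω → U` -/

namespace IwU

/-- `U` is topologically finitely generated (w6-d120's two topological generators).
[cite: MochizukiSemiAnbd2006, Def 2.3(iii) p.25] -/
theorem isTopologicallyFinitelyGenerated : IsTopologicallyFinitelyGenerated (IwU p) := by
  obtain ⟨s, -, hs⟩ := IwU.exists_finset_topologicalClosure_eq_top (p := p)
  exact ⟨⟨s, hs⟩⟩

/-- The characteristic open cores of `U` are open. [cite: DixonEtAl1999, Prop 1.6] -/
theorem isOpen_charOpenCore' (d : ℕ) : IsOpen (charOpenCore (IwU p) d : Set (IwU p)) :=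
  isOpen_charOpenCore_of_tfg IwU.isTopologicallyFinitelyGenerated d

/-- The characteristic open cores of `U` have finite index. [cite: DixonEtAl1999, Prop 1.6] -/
theorem finiteIndex_charOpenCore' (d : ℕ) : (charOpenCore (IwU p) d).FiniteIndex :=
  finiteIndex_charOpenCore_of_tfg IwU.isTopologicallyFinitelyGenerated d

end IwU

namespace IwSeq

/-- `s ↦ 1 + p s` is multiplicative on the unit coordinates of `P_ω` (the projection `P_ω → U` is a
homomorphism). [cite: MochizukiSemiAnbd2006, §2 p.23] -/
theorem w_mul_s (x y : IwSeq p) : w p (x * y).s = w p x.s * w p y.s := by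
  rw [IwSeq.mul_s, w_mul_w]

/-- The unit coordinate is conjugation-invariant (the projection `P_ω → U` has abelian target).
[cite: MochizukiSemiAnbd2006, §2 p.23] -/
theorem conj_s (x y : IwSeq p) : (x * y * x⁻¹).s = y.s := by
  have h1 : w p (x * y * x⁻¹).s * w p x.s = w p y.s * w p x.s :=
    calc w p (x * y * x⁻¹).s * w p x.s = w p (x * y * x⁻¹ * x).s := (w_mul_s _ _).symm
      _ = w p (x * y).s := by rw [inv_mul_cancel_right]
      _ = w p x.s * w p y.s := w_mul_s _ _
      _ = w p y.s * w p x.s := mul_comm _ _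
  have h2 : w p (x * y * x⁻¹).s = w p y.s := (isUnit_w p x.s).mul_left_injective h1
  simp only [w] at h2
  exact mul_left_cancel₀ Iw.p_ne_zero (add_left_cancel h2)

end IwSeq

/-- The fixator of a finite object is a normal subgroup (it is the kernel of the permutation
representation). [cite: MochizukiSemiAnbd2006, §3 p.33] -/
theorem ProfiniteSemiGraph.CovObj.fixator_normal {L : Type u} [Group L] [TopologicalSpace L] (Y : BTemp L) :
    (CovObj.fixator Y).Normal := by
  letI : MulAction L Y.obj.V := Action.instMulAction Y.obj
  exact MonoidHom.normal_ker (MulAction.toPermHom L Y.obj.V)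

namespace IwSeqWitness

variable (p)

/-! ### 2. The components (vertex and edge groups) of `G_{S_ω}`: all stabilisers are everything -/

/-- The edge groups of `G_{S_ω}` are (the stabilisers, i.e.) all of `U`. [cite: MochizukiSemiAnbd2006, Def 3.5(i) p.37] -/
theorem stabE_seqUnwinding_eq_top (e' : (seqUnwinding p).coveringGraph.graph.Edge) :
    BTemp.stab ((seqUnwinding p).SE e'.1) (Quot.out e'.2) = ⊤ :=
  eq_top_iff.2 fun _ _ => rfl

/-- The vertex groups of `G_{S_ω}` are all of `P_ω`. [cite: MochizukiSemiAnbd2006, Def 3.5(i) p.37] -/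
theorem stabV_seqUnwinding_eq_top (v' : (seqUnwinding p).coveringGraph.graph.Vertex) :
    BTemp.stab ((seqUnwinding p).SV v'.1) (Quot.out v'.2) = ⊤ :=
  eq_top_iff.2 fun _ _ => rfl

/-- **The key identity**: the projection `P_ω → U`, `x ↦ 1 + p·x.s`, splits every branch homomorphism
`k ↦ g_{b'} · b_c(k) · g_{b'}⁻¹` of `G_{S_ω}`. [cite: MochizukiSemiAnbd2006, Def 3.5(i) p.37] -/
theorem sU_coveringGraph_brHom (β : (seqUnwinding p).coveringGraph.graph.Branch)
    (v' : (seqUnwinding p).coveringGraph.graph.Vertex)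
    (h : (seqUnwinding p).coveringGraph.graph.abuts β = some v')
    (g : (seqUnwinding p).coveringGraph.Ge ((seqUnwinding p).coveringGraph.graph.edgeOf β)) :
    (⟨(((seqUnwinding p).coveringGraph.brHom β v' h g : (seqUnwinding p).coveringGraph.Gv v') :
      IwSeq p).s⟩ : IwU p) = (g : IwU p) := by
  apply IwU.ext
  change ((seqUnwinding p).conjugator h * IwSeq.bHomSeq (cvec p β.1) g.1 *
    ((seqUnwinding p).conjugator h)⁻¹).s = g.1.s
  rw [IwSeq.conj_s, IwSeq.bHomSeq_s]

/-- An element of an edge group of `G_{S_ω}` lying in the characteristic open core `charOpenCore U M`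
acts trivially on every `U`-set of size `≤ M` over that edge group. [cite: MochizukiSemiAnbd2006, Def 2.3(iii) p.25] -/
theorem charOpenCore_acts_trivially_edge {M : ℕ} (e' : (seqUnwinding p).coveringGraph.graph.Edge)
    (X : BTemp ((seqUnwinding p).coveringGraph.Ge e')) [Finite X.obj.V] (hX : Nat.card X.obj.V ≤ M)
    (g : (seqUnwinding p).coveringGraph.Ge e') (hg : (g : IwU p) ∈ charOpenCore (IwU p) M)
    (x : X.obj.V) : X.obj.ρ g x = x := by
  have hidx : (BTemp.stab ((seqUnwinding p).SE e'.1) (Quot.out e'.2)).index = 1 := by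
    rw [stabE_seqUnwinding_eq_top, Subgroup.index_top]
  refine CovObj.charOpenCore_acts_trivially (BTemp.stab ((seqUnwinding p).SE e'.1) (Quot.out e'.2))
    (((seqUnwinding p).SE e'.1).property.2 _) ?_ X (B := M) ?_ g hg x
  · rw [hidx]; exact one_ne_zero
  · rw [hidx, one_mul]; exact hX

/-! ### 3. Quasi-coherence of `G_{S_ω}` -/

/-- **`G_{S_ω}` is quasi-coherent** ([SemiAnbd] Def. 2.3 (iii) for the covering semi-graph of anabelioids
of the `ℤ`-unwinding of the incoherent Thm-3.7-grade loop `𝒢_ω`): for test objects of size `≤ M`, the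
approximator at the uniform `U`-level `W = charOpenCore U M` — vertex groups
`P_ω / (fixator ∩ s⁻¹ W)`, edge groups `U / W`, branch maps induced by the covering branch
homomorphisms (injective since `s` splits them), orders bounded by `(M!·[U:W])!`.
[cite: MochizukiSemiAnbd2006, Def 2.3(iii) p.25] -/
theorem isQuasiCoherent_coveringGraph_seqUnwinding :
    (seqUnwinding p).coveringGraph.IsQuasiCoherent := by
  classical
  intro M HV HE hV hE
  haveI hVfin : ∀ v', Finite (HV v').obj.V := fun v' => (hV v').2
  haveI hEfin : ∀ e', Finite (HE e').obj.V := fun e' => (hE e').2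
  -- the uniform `U`-level
  set W : Subgroup (IwU p) := charOpenCore (IwU p) M
  have hWo : IsOpen (W : Set (IwU p)) := IwU.isOpen_charOpenCore' M
  haveI hWfi : W.FiniteIndex := IwU.finiteIndex_charOpenCore' M
  haveI hWn : W.Normal := charOpenCore_normal (Γ := IwU p) M
  haveI hfixN : ∀ v', (CovObj.fixator (HV v')).Normal := fun v' => CovObj.fixator_normal (HV v')
  haveI hfixF : ∀ v', (CovObj.fixator (HV v')).FiniteIndex := fun v' =>
    ⟨CovObj.index_fixator_ne_zero (HV v')⟩
  -- the projections `Π_{v'} = Stab ⊆ P_ω → U`, `x ↦ 1 + p·x.s`, and their continuity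
  let sV : ∀ v' : (seqUnwinding p).coveringGraph.graph.Vertex,
      (seqUnwinding p).coveringGraph.Gv v' →* IwU p := fun v' =>
    { toFun := fun g => ⟨(g : IwSeq p).s⟩
      map_one' := rfl
      map_mul' := fun _ _ => rfl }
  have hsVc : ∀ v' : (seqUnwinding p).coveringGraph.graph.Vertex,
      Continuous fun g : (seqUnwinding p).coveringGraph.Gv v' => (⟨(g : IwSeq p).s⟩ : IwU p) := fun v' =>
    IwU.continuous_mk_iff.2 (IwSeq.continuous_s.comp continuous_subtype_val)
  -- the homomorphisms whose kernels define the finite quotients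
  let φ : ∀ v' : (seqUnwinding p).coveringGraph.graph.Vertex, (seqUnwinding p).coveringGraph.Gv v' →*
      ((seqUnwinding p).coveringGraph.Gv v' ⧸ CovObj.fixator (HV v')) × (IwU p ⧸ W) := fun v' =>
    (QuotientGroup.mk' (CovObj.fixator (HV v'))).prod ((QuotientGroup.mk' W).comp (sV v'))
  let ψ : ∀ e' : (seqUnwinding p).coveringGraph.graph.Edge,
      (seqUnwinding p).coveringGraph.Ge e' →* IwU p ⧸ W := fun e' =>
    (QuotientGroup.mk' W).comp (Subgroup.subtype _)
  have hφapp : ∀ v' (g : (seqUnwinding p).coveringGraph.Gv v'), φ v' g =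
      (((g : (seqUnwinding p).coveringGraph.Gv v') :
          (seqUnwinding p).coveringGraph.Gv v' ⧸ CovObj.fixator (HV v')),
        ((⟨(g : IwSeq p).s⟩ : IwU p) : IwU p ⧸ W)) := fun _ _ => rfl
  have hψapp : ∀ e' (g : (seqUnwinding p).coveringGraph.Ge e'),
      ψ e' g = ((g : IwU p) : IwU p ⧸ W) := fun _ _ => rfl
  have hφ : ∀ v' (g : (seqUnwinding p).coveringGraph.Gv v'),
      g ∈ (φ v').ker ↔ g ∈ CovObj.fixator (HV v') ∧ (⟨(g : IwSeq p).s⟩ : IwU p) ∈ W := by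
    intro v' g
    rw [MonoidHom.mem_ker, hφapp, Prod.mk_eq_one, QuotientGroup.eq_one_iff, QuotientGroup.eq_one_iff]
  have hψ : ∀ e' (g : (seqUnwinding p).coveringGraph.Ge e'), g ∈ (ψ e').ker ↔ (g : IwU p) ∈ W := by
    intro e' g
    rw [MonoidHom.mem_ker, hψapp, QuotientGroup.eq_one_iff]
  -- the branch homomorphisms carry `W` (pulled back to the edge groups) into the vertex kernels
  have hWfix : ∀ (β : (seqUnwinding p).coveringGraph.graph.Branch)
      (v' : (seqUnwinding p).coveringGraph.graph.Vertex)
      (h : (seqUnwinding p).coveringGraph.graph.abuts β = some v')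
      (g : (seqUnwinding p).coveringGraph.Ge ((seqUnwinding p).coveringGraph.graph.edgeOf β)),
      (g : IwU p) ∈ W → (seqUnwinding p).coveringGraph.brHom β v' h g ∈ CovObj.fixator (HV v') := by
    intro β v' h g hg
    rw [CovObj.mem_fixator_iff]
    intro y
    haveI : Finite ((BTemp.res ((seqUnwinding p).coveringGraph.brHom β v' h)).obj (HV v')).obj.V :=
      hVfin v'
    have := charOpenCore_acts_trivially_edge p (M := M) _
      ((BTemp.res ((seqUnwinding p).coveringGraph.brHom β v' h)).obj (HV v')) (hV v').1 g hg y
    rwa [BTemp.res_obj_ρ_apply] at this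
  have hle : ∀ (β : (seqUnwinding p).coveringGraph.graph.Branch)
      (v' : (seqUnwinding p).coveringGraph.graph.Vertex)
      (h : (seqUnwinding p).coveringGraph.graph.abuts β = some v'),
      (ψ ((seqUnwinding p).coveringGraph.graph.edgeOf β)).ker ≤
        ((φ v').ker).comap ((seqUnwinding p).coveringGraph.brHom β v' h).toMonoidHom := by
    intro β v' h g hg
    rw [hψ] at hg
    rw [Subgroup.mem_comap, hφ]
    refine ⟨hWfix β v' h g hg, ?_⟩
    change (⟨(((seqUnwinding p).coveringGraph.brHom β v' h g :
      (seqUnwinding p).coveringGraph.Gv v') : IwSeq p).s⟩ : IwU p) ∈ W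
    rw [sU_coveringGraph_brHom]
    exact hg
  refine ⟨{ FV := fun v' => (seqUnwinding p).coveringGraph.Gv v' ⧸ (φ v').ker
            FE := fun e' => (seqUnwinding p).coveringGraph.Ge e' ⧸ (ψ e').ker
            finiteFV := fun v' => Finite.of_injective _ (QuotientGroup.kerLift_injective (φ v'))
            finiteFE := fun e' => Finite.of_injective _ (QuotientGroup.kerLift_injective (ψ e'))
            πV := fun v' => QuotientGroup.mk' (φ v').ker
            πE := fun e' => QuotientGroup.mk' (ψ e').ker
            isOpen_ker_πV := ?_
            isOpen_ker_πE := ?_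
            brF := fun β v' h => QuotientGroup.map _ (φ v').ker
              ((seqUnwinding p).coveringGraph.brHom β v' h).toMonoidHom (hle β v' h)
            brF_injective := ?_
            comm := ?_
            bounded := ?_ }, ?_, ?_⟩
  · -- open kernels (vertices)
    intro v'
    dsimp only
    rw [QuotientGroup.ker_mk']
    have hset : (((φ v').ker : Subgroup ((seqUnwinding p).coveringGraph.Gv v')) :
        Set ((seqUnwinding p).coveringGraph.Gv v')) =
        (CovObj.fixator (HV v') : Set ((seqUnwinding p).coveringGraph.Gv v')) ∩
          (fun g : (seqUnwinding p).coveringGraph.Gv v' => (⟨(g : IwSeq p).s⟩ : IwU p)) ⁻¹'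
            (W : Set (IwU p)) := by
      ext g
      exact hφ v' g
    rw [hset]
    exact (CovObj.isOpen_fixator (HV v')).inter
      (hWo.preimage (hsVc v'))
  · -- open kernels (edges)
    intro e'
    dsimp only
    rw [QuotientGroup.ker_mk']
    have hset : (((ψ e').ker : Subgroup ((seqUnwinding p).coveringGraph.Ge e')) :
        Set ((seqUnwinding p).coveringGraph.Ge e')) = Subtype.val ⁻¹' (W : Set (IwU p)) := by
      ext g
      exact hψ e' g
    rw [hset]
    exact hWo.preimage continuous_subtype_val
  · -- injective branch maps: `s` splits the covering branch homomorphisms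
    intro β v' h
    refine (injective_iff_map_eq_one _).2 fun x hx => ?_
    obtain ⟨g, rfl⟩ := QuotientGroup.mk_surjective x
    have hg : (seqUnwinding p).coveringGraph.brHom β v' h g ∈ (φ v').ker := by
      dsimp only at hx
      rw [QuotientGroup.map_mk, QuotientGroup.eq_one_iff] at hx
      exact hx
    rw [hφ] at hg
    have h2 := hg.2
    rw [sU_coveringGraph_brHom] at h2
    rw [QuotientGroup.eq_one_iff, hψ]
    exact h2
  · -- trivial compatibility 2-cells
    intro β v' h
    refine ⟨1, fun x => ?_⟩
    rw [one_mul, inv_one, mul_one]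
    rfl
  · -- bounded order
    refine ⟨(M.factorial * W.index).factorial, Nat.factorial_pos _, fun v' => ?_⟩
    haveI : Finite ((seqUnwinding p).coveringGraph.Gv v' ⧸ (φ v').ker) :=
      Finite.of_injective _ (QuotientGroup.kerLift_injective (φ v'))
    refine Nat.dvd_factorial Nat.card_pos ?_
    calc Nat.card ((seqUnwinding p).coveringGraph.Gv v' ⧸ (φ v').ker)
        ≤ Nat.card (((seqUnwinding p).coveringGraph.Gv v' ⧸ CovObj.fixator (HV v')) × (IwU p ⧸ W)) :=
          Nat.card_le_card_of_injective _ (QuotientGroup.kerLift_injective (φ v'))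
      _ = (CovObj.fixator (HV v')).index * W.index := by rw [Nat.card_prod]; rfl
      _ ≤ M.factorial * W.index :=
          Nat.mul_le_mul_right _ ((CovObj.index_fixator_le _).trans (Nat.factorial_le (hV v').1))
  · -- the vertex kernels fix the test objects
    intro v' g hg x
    have hg' : g ∈ (φ v').ker := (QuotientGroup.eq_one_iff g).1 hg
    exact ((CovObj.mem_fixator_iff _ _).1 ((hφ v' g).1 hg').1) x
  · -- the edge kernels fix the test objects
    intro e' g hg x
    have hg' : (g : IwU p) ∈ W := (hψ e' g).1 ((QuotientGroup.eq_one_iff g).1 hg)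
    exact charOpenCore_acts_trivially_edge p e' (HE e') (hE e').1 g hg' x

/-! ### 4. The remaining clauses of Prop. 3.6 / Thm. 3.7 at `G_{S_ω}`, by name -/

/-- `G_{S_ω}` is countable. [cite: MochizukiSemiAnbd2006, §1 p.11] -/
theorem isCountable_coveringGraph_seqUnwinding : (seqUnwinding p).coveringGraph.IsCountable :=
  (seqUnwinding p).isCountable_coveringGraph (seqLoop_isCountable p)

/-- `G_{S_ω}` is a graph. [cite: MochizukiSemiAnbd2006, §1 p.11] -/
theorem isGraph_coveringGraph_seqUnwinding : (seqUnwinding p).coveringGraph.IsGraph :=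
  (seqUnwinding p).isGraph_coveringGraph (seqLoop_isGraph p)

/-- `G_{S_ω}` is of injective type. [cite: MochizukiSemiAnbd2006, Def 2.1 p.22] -/
theorem isOfInjectiveType_coveringGraph_seqUnwinding : (seqUnwinding p).coveringGraph.IsOfInjectiveType :=
  (seqUnwinding p).isOfInjectiveType_coveringGraph (seqLoop_isOfInjectiveType p)

/-- `G_{S_ω}` is verticially slim. [cite: MochizukiSemiAnbd2006, Def 2.4(ii) p.25] -/
theorem isVerticiallySlim_coveringGraph_seqUnwinding : (seqUnwinding p).coveringGraph.IsVerticiallySlim :=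
  (seqUnwinding p).isVerticiallySlim_coveringGraph (seqLoop_isVerticiallySlim p)

/-- `G_{S_ω}` is totally aloof. [cite: MochizukiSemiAnbd2006, Def 2.4(iv) p.26] -/
theorem isTotallyAloof_coveringGraph_seqUnwinding : (seqUnwinding p).coveringGraph.IsTotallyAloof :=
  (seqUnwinding p).isTotallyAloof_coveringGraph (seqLoop_isTotallyAloof p)

/-- `G_{S_ω}` is totally estranged. [cite: MochizukiSemiAnbd2006, Def 2.4(iv) p.26] -/
theorem isTotallyEstranged_coveringGraph_seqUnwinding : (seqUnwinding p).coveringGraph.IsTotallyEstranged :=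
  (seqUnwinding p).isTotallyEstranged_coveringGraph (seqLoop_isTotallyEstranged p)

/-- `G_{S_ω}` is totally elevated. [cite: MochizukiSemiAnbd2006, Def 2.4(i) p.25] -/
theorem isTotallyElevated_coveringGraph_seqUnwinding : (seqUnwinding p).coveringGraph.IsTotallyElevated :=
  (seqUnwinding p).isTotallyElevated_coveringGraph (seqLoop_isTotallyElevated p) (seqUnwinding_isTempered p)

/-- `G_{S_ω}` is NOT coherent: its vertex groups are copies of `P_ω`, which is not topologically
finitely generated. [cite: MochizukiSemiAnbd2006, Def 2.3(iii) p.25] -/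
theorem not_isCoherent_coveringGraph_seqUnwinding : ¬ (seqUnwinding p).coveringGraph.IsCoherent := by
  classical
  rintro ⟨-, hV, -⟩
  obtain ⟨S, hS⟩ := hV (vtx p 0)
  refine IwSeq.not_topologicallyFG (p := p)
    ⟨S.image (Subgroup.subtype (BTemp.stab ((seqUnwinding p).SV (vtx p 0).1) (Quot.out (vtx p 0).2))), ?_⟩
  rw [Finset.coe_image, ← MonoidHom.map_closure, eq_top_iff]
  rintro x -
  -- transport along the isomorphism `Stab = ⊤ ≃ P_ω`: `x` lies in the (whole) stabiliser
  have hxT : x ∈ BTemp.stab ((seqUnwinding p).SV (vtx p 0).1) (Quot.out (vtx p 0).2) := rfl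
  have hc : Continuous
      (Subgroup.subtype (BTemp.stab ((seqUnwinding p).SV (vtx p 0).1) (Quot.out (vtx p 0).2))) :=
    continuous_subtype_val
  rw [← SetLike.mem_coe, Subgroup.topologicalClosure_coe, Subgroup.coe_map]
  refine image_closure_subset_closure_image hc ⟨⟨x, hxT⟩, ?_, rfl⟩
  rw [← Subgroup.topologicalClosure_coe, SetLike.mem_coe, hS]
  exact Subgroup.mem_top _

/-! ### 5. Records: at `G_{S_ω}` the hypothesis bundles are equivalent to their (T2)-clause -/

/-- **All clauses of Thm. 3.7's hypotheses hold at `G_{S_ω}`, except Galois-countability (T2).**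
FRONTIER / tightness datum. [cite: MochizukiSemiAnbd2006, Thm 3.7 p.40] -/
theorem coveringGraph_seqUnwinding_clauses :
    (seqUnwinding p).coveringGraph.IsConnected ∧ (seqUnwinding p).coveringGraph.IsCountable ∧
      (seqUnwinding p).coveringGraph.HasVertex ∧ (seqUnwinding p).coveringGraph.IsOfInjectiveType ∧
      (seqUnwinding p).coveringGraph.IsQuasiCoherent ∧ (seqUnwinding p).coveringGraph.IsTotallyElevated ∧
      (seqUnwinding p).coveringGraph.IsTotallyAloof ∧ (seqUnwinding p).coveringGraph.IsTotallyEstranged ∧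
      (seqUnwinding p).coveringGraph.IsVerticiallySlim ∧ (seqUnwinding p).coveringGraph.IsGraph ∧
      ¬ (seqUnwinding p).coveringGraph.IsCoherent ∧ ¬ (seqUnwinding p).coveringGraph.IsGaloisCountable :=
  ⟨isConnected_coveringGraph_seqUnwinding p, isCountable_coveringGraph_seqUnwinding p,
    hasVertex_coveringGraph_seqUnwinding p, isOfInjectiveType_coveringGraph_seqUnwinding p,
    isQuasiCoherent_coveringGraph_seqUnwinding p, isTotallyElevated_coveringGraph_seqUnwinding p,
    isTotallyAloof_coveringGraph_seqUnwinding p, isTotallyEstranged_coveringGraph_seqUnwinding p,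
    isVerticiallySlim_coveringGraph_seqUnwinding p, isGraph_coveringGraph_seqUnwinding p,
    not_isCoherent_coveringGraph_seqUnwinding p, not_isGaloisCountable_coveringGraph_seqUnwinding p⟩

/-- **At `G_{S_ω}`, `Prop36Hypotheses` is EQUIVALENT to its (T2)-clause** (every other clause holds):
the heredity failure of `CoveringGraphGaloisCountableNegativeThm37` is located exactly at
Galois-countability. FRONTIER / tightness datum. [cite: MochizukiSemiAnbd2006, Prop 3.6 p.38] -/
theorem prop36Hypotheses_coveringGraph_seqUnwinding_iff :
    (seqUnwinding p).coveringGraph.Prop36Hypotheses ↔ (seqUnwinding p).coveringGraph.IsGaloisCountable :=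
  ⟨fun h => h.isGaloisCountable, fun h =>
    { isConnected := isConnected_coveringGraph_seqUnwinding p
      isCountable := isCountable_coveringGraph_seqUnwinding p
      isGaloisCountable := h
      hasVertex := hasVertex_coveringGraph_seqUnwinding p
      isOfInjectiveType := isOfInjectiveType_coveringGraph_seqUnwinding p
      isQuasiCoherent := isQuasiCoherent_coveringGraph_seqUnwinding p
      isTotallyElevated := isTotallyElevated_coveringGraph_seqUnwinding p
      isTotallyAloof := isTotallyAloof_coveringGraph_seqUnwinding p
      isVerticiallySlim := isVerticiallySlim_coveringGraph_seqUnwinding p }⟩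

/-- **At `G_{S_ω}`, `Thm37Hypotheses` is EQUIVALENT to its (T2)-clause.** FRONTIER / tightness datum.
[cite: MochizukiSemiAnbd2006, Thm 3.7 p.40] -/
theorem thm37Hypotheses_coveringGraph_seqUnwinding_iff :
    (seqUnwinding p).coveringGraph.Thm37Hypotheses ↔ (seqUnwinding p).coveringGraph.IsGaloisCountable :=
  ⟨fun h => h.isGaloisCountable, fun h =>
    { toProp36Hypotheses := (prop36Hypotheses_coveringGraph_seqUnwinding_iff p).2 h
      isTotallyEstranged := isTotallyEstranged_coveringGraph_seqUnwinding p }⟩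

/-- **At `G_{S_ω}`, `Cor39Hypotheses` is EQUIVALENT to its (T2)-clause.** FRONTIER / tightness datum.
[cite: MochizukiSemiAnbd2006, Cor 3.9 p.42] -/
theorem cor39Hypotheses_coveringGraph_seqUnwinding_iff :
    Cor39Hypotheses (seqUnwinding p).coveringGraph ↔ (seqUnwinding p).coveringGraph.IsGaloisCountable :=
  ⟨fun h => h.isGaloisCountable, fun h =>
    { toProp36Hypotheses := (prop36Hypotheses_coveringGraph_seqUnwinding_iff p).2 h
      isTotallyEstranged := isTotallyEstranged_coveringGraph_seqUnwinding p
      isGraph := isGraph_coveringGraph_seqUnwinding p }⟩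

/-- `G_{S_ω}` does not satisfy the hypotheses of Prop. 3.6 — and ONLY because of (T2).
[cite: MochizukiSemiAnbd2006, Prop 3.6 p.38] -/
theorem not_prop36Hypotheses_coveringGraph_seqUnwinding : ¬ (seqUnwinding p).coveringGraph.Prop36Hypotheses :=
  fun h => not_isGaloisCountable_coveringGraph_seqUnwinding p
    ((prop36Hypotheses_coveringGraph_seqUnwinding_iff p).1 h)

/-- **The countermodel, with every clause decided**: a semi-graph of anabelioids satisfying ALL the
hypotheses of Thm. 3.7 / Cor. 3.9 (not coherent) and a connected tempered covering of it of infinite degree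
whose covering semi-graph of anabelioids is quasi-coherent, totally elevated, totally estranged,
verticially slim, of injective type, connected, countable — and NOT Galois-countable: in the heredity
theorem `CovObj.isGaloisCountable_coveringGraph_of_isCoherent` the hypothesis "coherent" cannot be weakened
to "quasi-coherent", and the failure is at (T2) alone. FRONTIER / tightness datum.
[cite: Mochizuki2012, IUTchI Rmk 2.5.3 (i) (T2), p. 52] -/
theorem exists_thm37Hypotheses_coveringGraph_all_clauses_but_galoisCountable :
    ∃ (𝒢 : ProfiniteSemiGraph.{0}) (S : CovObj 𝒢) (hS : S.IsTempered),
      𝒢.Thm37Hypotheses ∧ Cor39Hypotheses 𝒢 ∧ ¬ 𝒢.IsCoherent ∧ ¬ S.IsFinite ∧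
        IsConnectedObj (⟨S, hS⟩ : BTempCat 𝒢) ∧
        S.coveringGraph.IsConnected ∧ S.coveringGraph.IsCountable ∧ S.coveringGraph.HasVertex ∧
        S.coveringGraph.IsOfInjectiveType ∧ S.coveringGraph.IsQuasiCoherent ∧
        S.coveringGraph.IsTotallyElevated ∧ S.coveringGraph.IsTotallyEstranged ∧
        S.coveringGraph.IsVerticiallySlim ∧ ¬ S.coveringGraph.IsGaloisCountable ∧
        ¬ S.coveringGraph.Prop36Hypotheses :=
  haveI : Fact (Nat.Prime 2) := ⟨Nat.prime_two⟩
  ⟨seqLoop 2, seqUnwinding 2, seqUnwinding_isTempered 2, seqLoop_thm37Hypotheses 2,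
    seqLoop_cor39Hypotheses 2, seqLoop_not_isCoherent 2, seqUnwinding_not_isFinite 2,
    isConnectedObj_seqUnwinding 2, isConnected_coveringGraph_seqUnwinding 2,
    isCountable_coveringGraph_seqUnwinding 2, hasVertex_coveringGraph_seqUnwinding 2,
    isOfInjectiveType_coveringGraph_seqUnwinding 2, isQuasiCoherent_coveringGraph_seqUnwinding 2,
    isTotallyElevated_coveringGraph_seqUnwinding 2, isTotallyEstranged_coveringGraph_seqUnwinding 2,
    isVerticiallySlim_coveringGraph_seqUnwinding 2, not_isGaloisCountable_coveringGraph_seqUnwinding 2,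
    not_prop36Hypotheses_coveringGraph_seqUnwinding 2⟩

/-- **Heredity of the Prop-3.6 bundle MINUS (T2) does hold at `(𝒢_ω, S_ω)` while (T2) fails**: it is
false that quasi-coherence of `G_S` (together with all the other non-(T2) clauses) implies
Galois-countability of `G_S` for connected tempered coverings `S` of Thm-3.7-grade bases.
FRONTIER / tightness datum. [cite: Mochizuki2012, IUTchI Rmk 2.5.3 (i) (T2), p. 52] -/
theorem not_forall_isQuasiCoherent_coveringGraph_isGaloisCountable :
    ¬ ∀ (𝒢 : ProfiniteSemiGraph.{0}) (S : CovObj 𝒢) (hS : S.IsTempered), 𝒢.Thm37Hypotheses →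
        IsConnectedObj (⟨S, hS⟩ : BTempCat 𝒢) → S.coveringGraph.IsQuasiCoherent →
        S.coveringGraph.IsTotallyElevated → S.coveringGraph.IsTotallyEstranged →
        S.coveringGraph.IsGaloisCountable := fun h =>
  haveI : Fact (Nat.Prime 2) := ⟨Nat.prime_two⟩
  not_isGaloisCountable_coveringGraph_seqUnwinding 2 (h (seqLoop 2) (seqUnwinding 2)
    (seqUnwinding_isTempered 2) (seqLoop_thm37Hypotheses 2) (isConnectedObj_seqUnwinding 2)
    (isQuasiCoherent_coveringGraph_seqUnwinding 2) (isTotallyElevated_coveringGraph_seqUnwinding 2)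
    (isTotallyEstranged_coveringGraph_seqUnwinding 2))

end IwSeqWitness

end Literature.AnabelianGeometry.SemiGraphs

end
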